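import Mathlib


/-!
# Rational upper bounds for `log`, computable and kernel-checkable (venture `DiscreteObjects`, target L)

Cell `pub-namedobj`, seat `pub-namedobj-mahler-g14`. Framing: lottery ticket; floor = certified bounds/negative
ranges.

First primitive of the planned certificate checker for the auxiliary-function hypothesis (H) (`CensusAuxiliaryCuts.AuxBound`,
rectangle form `CensusAuxiliaryChebyshev.auxBound_of_uw`): a COMPUTABLE `logUB : ℚ → ℚ` with `Real.log x ≤ logUB x` for every
rational `x > 0` (`log_le_logUB`).  Reduction `x = m · (5/4)^s` with `m ∈ [1, 5/4)` (for `x` in the huge range `(4/5)^N … (5/4)^N`,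
`N = logFuel`; outside it the bound degrades gracefully to `log m ≤ m - 1`), two certified constants
`2229/10000 ≤ log(5/4) ≤ 2234/10000` (from `1 + y ≤ e^y` via `(1 + L/128)^128 ≤ e^L` and `(1 - L/128)^128 ≤ e^{-L}`; `norm_num`), and the series
bound `log(1+y) ≤ y - y²/2 + y³/3 - y⁴/4 + y⁵/5 + y⁶/(1-y)` for `0 ≤ y < 1` (Mathlib `Real.abs_log_sub_add_sum_range_le`).
Accuracy: `logUB x - log x ≤ 2.6·10⁻⁴·|s| + 3.4·10⁻⁴` for `x = m(5/4)^s` in range.  No `native_decide`; the two constant checks are `norm_num`.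
-/

namespace Summit.Ventures.DiscreteObjects.Mahler

/-! ## The series bound on `[1, 2)` -/

/-- `y - y²/2 + y³/3 - y⁴/4 + y⁵/5 + y⁶/(1-y)` (an upper bound for `log(1+y)`, `0 ≤ y < 1`), and the fallback `y` otherwise. -/
def logSeriesUB (y : ℚ) : ℚ :=
  if 0 ≤ y ∧ y < 1 then y - y ^ 2 / 2 + y ^ 3 / 3 - y ^ 4 / 4 + y ^ 5 / 5 + y ^ 6 / (1 - y) else y

/-- `log(1 + y) ≤ logSeriesUB y` for `-1 < y`. -/
theorem log_one_add_le_logSeriesUB {y : ℚ} (hy : -1 < (y : ℝ)) : Real.log (1 + y) ≤ (logSeriesUB y : ℝ) := by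
  unfold logSeriesUB
  split_ifs with h
  · obtain ⟨h0, h1⟩ := h
    have h0' : (0 : ℝ) ≤ y := by exact_mod_cast h0
    have h1' : (y : ℝ) < 1 := by exact_mod_cast h1
    have habs : |(-(y : ℝ))| < 1 := by rw [abs_neg, abs_of_nonneg h0']; exact h1'
    have hser := Real.abs_log_sub_add_sum_range_le habs 5
    rw [abs_neg, abs_of_nonneg h0', sub_neg_eq_add] at hser
    have hsum : ∑ i ∈ Finset.range 5, (-(y : ℝ)) ^ (i + 1) / (i + 1) =
        -(y : ℝ) + y ^ 2 / 2 - y ^ 3 / 3 + y ^ 4 / 4 - y ^ 5 / 5 := by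
      simp only [Finset.sum_range_succ, Finset.sum_range_zero]
      norm_num
      ring
    rw [hsum] at hser
    have := (abs_le.mp hser).2
    push_cast
    linarith
  · have := Real.log_le_sub_one_of_pos (show (0 : ℝ) < 1 + y by linarith)
    linarith

/-! ## The constants `log(5/4)` -/

/-- `(1 + L/n)^n ≤ e^L` for `0 ≤ 1 + L/n`. -/
theorem one_add_div_pow_le_exp (L : ℝ) (n : ℕ) (hn : 0 < n) (h : 0 ≤ 1 + L / n) : (1 + L / n) ^ n ≤ Real.exp L := by
  have h1 : 1 + L / n ≤ Real.exp (L / n) := by have := Real.add_one_le_exp (L / n); linarith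
  calc (1 + L / n) ^ n ≤ Real.exp (L / n) ^ n := pow_le_pow_left₀ h h1 n
    _ = Real.exp L := by rw [← Real.exp_nat_mul]; congr 1; field_simp

/-- `log(5/4) ≤ 2234/10000`. -/
theorem log_five_fourths_le : Real.log ((5 : ℝ) / 4) ≤ (2234 : ℝ) / 10000 := by
  rw [Real.log_le_iff_le_exp (by norm_num)]
  have h := one_add_div_pow_le_exp ((2234 : ℝ) / 10000) 128 (by norm_num) (by norm_num)
  refine le_trans ?_ h
  norm_num

/-- `2229/10000 ≤ log(5/4)`. -/
theorem le_log_five_fourths : (2229 : ℝ) / 10000 ≤ Real.log ((5 : ℝ) / 4) := by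
  rw [Real.le_log_iff_exp_le (by norm_num)]
  -- `e^L ≤ ((1 - L/128)^128)⁻¹` from `(1 - L/128)^128 ≤ e^{-L}`
  have h := one_add_div_pow_le_exp (-((2229 : ℝ) / 10000)) 128 (by norm_num) (by norm_num)
  rw [Real.exp_neg] at h
  have hpos : (0 : ℝ) < (1 + -(2229 / 10000 : ℝ) / (128 : ℕ)) ^ 128 := by positivity
  have h2 : Real.exp (2229 / 10000 : ℝ) ≤ ((1 + -(2229 / 10000 : ℝ) / (128 : ℕ)) ^ 128)⁻¹ := by
    rw [le_inv_comm₀ (Real.exp_pos _) hpos]; exact h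
  refine h2.trans ?_
  norm_num

/-! ## Reduction to `[1, 5/4)` and the bound -/

/-- Fuel for the reduction (covers `x ∈ [(4/5)^600, (5/4)^600]` exactly; beyond, the bound is still valid but coarser). -/
def logFuel : ℕ := 600

/-- Reduce `x` to `m · (5/4)^s`: returns `(s, m)`, with `m ∈ [1, 5/4)` when the fuel suffices. -/
def logReduce : ℕ → ℚ → ℤ × ℚ
  | 0, x => (0, x)
  | fuel + 1, x =>
    if (5 : ℚ) / 4 ≤ x then let r := logReduce fuel (x * 4 / 5); (r.1 + 1, r.2)
    else if x < 1 then let r := logReduce fuel (x * 5 / 4); (r.1 - 1, r.2)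
    else (0, x)

/-- The invariant of the reduction: `x = m · (5/4)^s`. -/
theorem logReduce_spec : ∀ (fuel : ℕ) (x : ℚ),
    (x : ℝ) = ((logReduce fuel x).2 : ℝ) * ((5 : ℝ) / 4) ^ ((logReduce fuel x).1 : ℤ) := by
  intro fuel
  induction fuel with
  | zero => intro x; simp [logReduce]
  | succ fuel ih =>
    intro x
    unfold logReduce
    split_ifs with h1 h2
    · have hih := ih (x * 4 / 5)
      have hx : (x : ℝ) = ((x * 4 / 5 : ℚ) : ℝ) * ((5 : ℝ) / 4) := by push_cast; ring
      simp only
      rw [zpow_add_one₀ (by norm_num), hx, hih]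
      ring
    · have hih := ih (x * 5 / 4)
      have hx : (x : ℝ) = ((x * 5 / 4 : ℚ) : ℝ) * ((5 : ℝ) / 4)⁻¹ := by push_cast; ring
      simp only
      rw [zpow_sub_one₀ (by norm_num), hx, hih]
      ring
    · simp

/-- Positivity is preserved by the reduction. -/
theorem logReduce_pos : ∀ (fuel : ℕ) (x : ℚ), 0 < x → 0 < (logReduce fuel x).2 := by
  intro fuel
  induction fuel with
  | zero => intro x hx; simpa [logReduce] using hx
  | succ fuel ih =>
    intro x hx
    unfold logReduce
    split_ifs with h1 h2
    · exact ih _ (by positivity)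
    · exact ih _ (by positivity)
    · exact hx

/-- The bound assembled from a reduction `(s, m)`: `s · log(5/4)↑↓ + series(m - 1)`. -/
def logUBAux (r : ℤ × ℚ) : ℚ :=
  (if 0 ≤ r.1 then (r.1 : ℚ) * (2234 / 10000) else (r.1 : ℚ) * (2229 / 10000)) + logSeriesUB (r.2 - 1)

/-- **Computable upper bound for `log`** on positive rationals. -/
def logUB (x : ℚ) : ℚ := logUBAux (logReduce logFuel x)

/-- **Soundness:** `log x ≤ logUB x` for rational `x > 0`. -/
theorem log_le_logUB (x : ℚ) (hx : 0 < x) : Real.log (x : ℝ) ≤ (logUB x : ℝ) := by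
  unfold logUB logUBAux
  set r := logReduce logFuel x with hr
  have hm : 0 < r.2 := logReduce_pos logFuel x hx
  have hm' : (0 : ℝ) < r.2 := by exact_mod_cast hm
  have hx' : (x : ℝ) = (r.2 : ℝ) * ((5 : ℝ) / 4) ^ (r.1 : ℤ) := logReduce_spec logFuel x
  have hlog : Real.log (x : ℝ) = Real.log (r.2 : ℝ) + (r.1 : ℝ) * Real.log ((5 : ℝ) / 4) := by
    rw [hx', Real.log_mul hm'.ne' (zpow_pos (by norm_num) _).ne', Real.log_zpow]
  have hser : Real.log (r.2 : ℝ) ≤ (logSeriesUB (r.2 - 1) : ℝ) := by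
    have := log_one_add_le_logSeriesUB (y := r.2 - 1) (by push_cast; linarith)
    push_cast at this
    rwa [add_sub_cancel] at this
  rw [hlog]
  by_cases hs : 0 ≤ r.1
  · rw [if_pos hs]
    have hs' : (0 : ℝ) ≤ (r.1 : ℝ) := by exact_mod_cast hs
    have := mul_le_mul_of_nonneg_left log_five_fourths_le hs'
    push_cast
    linarith
  · rw [if_neg hs]
    push Not at hs
    have hs' : (r.1 : ℝ) ≤ 0 := by exact_mod_cast hs.le
    have := mul_le_mul_of_nonpos_left le_log_five_fourths hs'
    push_cast
    linarith

/-- Kernel-evaluation smoke test (`decide +kernel`, no `native_decide`): `log(5/2) = 0.91629… ≤ logUB (5/2) < 0.9175`. -/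
example : logUB (5 / 2) < 9175 / 10000 := by decide +kernel

/-- … and the bound is not vacuous from below: `0.9162 < logUB (5/2)`. -/
example : (9162 : ℚ) / 10000 < logUB (5 / 2) := by decide +kernel

end Summit.Ventures.DiscreteObjects.Mahler
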